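import Literature.AlgebraicGeometry.Pohlmann1968.CMFamilyRankPartitionSlots
import Literature.NumberTheory.ComplexMultiplication.CMTypeRankQuadraticSexticSlotConj
import Literature.NumberTheory.ComplexMultiplication.SexticCMFieldQuadraticOrPairFlip
import Literature.NumberTheory.ComplexMultiplication.QuarticCMTypes
import Literature.NumberTheory.ComplexMultiplication.CMFieldConjSquareQuadraticSubfields
import Summits.HodgeConjecture.CorCM.GenericSexticThreefoldTimesCMHodge
import Summits.HodgeConjecture.CorCM.ForeignQuadraticCMFieldsHodge
import Summits.HodgeConjecture.CorCM.ImaginaryQuadraticsTimesConjSquareCMHodge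
import Summits.HodgeConjecture.CorCM.CMEllipticCurveTimesSimpleCMThreefold
import HarnessLib

/-!
# Two simple CM abelian varieties of dimension `≤ 3` with DIFFERENT Galois closures and no common imaginary quadratic
# field: the character modules of their Hodge groups share no simple factor

COR-CM (cell `pub-hodgecm2`, binder seat `b16` gen 43, count-neutral claim CM-DIMLE3-PRODUCTS, file F4; theorems only, no
definition, no named fact, no `sorry`).  NEW as stated, hence under `Summits/`.  This is the PAIR KIT for products of ANY
NUMBER of simple CM abelian varieties of dimension `≤ 3` (`CorCM/SimpleCMDistinctClosuresHodge`): the n-ary criteria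
(`PairwiseCMFamiliesHodge.isNondegenerateFamily_iff_forall_of_pairwise`, and block by block
`Pohlmann1968/CMFamilyRankPartitionSlots`) ask, for every pair of slots `i ≠ j`, that the `Aut(ℂ)`-modules `U(Φ_i)`,
`U(Φ_j)` have NO COMMON CONSTITUENT — a condition on the pair which is STRONGER than nondegeneracy of the pair (two
Galois-conjugate threefolds with one pair-flip field form a nondegenerate pair with `U(Φ_i) ≅ U(Φ_j)`).  For two simple CM
abelian varieties of dimension `≤ 3` whose CM fields `K_i`, `K_j` have DIFFERENT Galois closures `L_i ≠ L_j` in `ℂ` and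
share NO imaginary quadratic subfield it always holds (`pairwise_simple_dim_le_three_of_normalClosure_ne`), by kind:

| `K_i` \ `K_j` | curve | surface | threefold, pair flips | threefold `⊇ k` |
|---|---|---|---|---|
| curve (`k_i ↪̸ K_j`) | foreign quadratic slot | ″ | ″ | ″ |
| surface | | (κ): `U` irreducible, `L_i ⊄ L_j` or `L_j ⊄ L_i` | (α): `dim 2 < 3` | (λ): `L_j ⊄ L_i` (`6 ∤ [L_i:ℚ] ∈ {4,8}`), `k ↪̸ K_i` |
| threefold, pair flips | | | (κ) | (α): eigenline of `k` |
| threefold `⊇ k` | | | | (λ): `L_i ⊄ L_j` or `L_j ⊄ L_i`, `k_i ↪̸ K_j`, `k_j ↪̸ K_i` |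

with (κ) = `pairwise_of_irreducible_of_not_normalClosure_le`, (λ) = `pairwise_of_quadratic_sextic_of_not_le`,
(α) = `pairwise_of_irreducible_of_finrank_le`, curves = `pairwise_of_isEmpty` (all in the tree).  §1 supplies the slot
facts: `U(Φ)` of a nondegenerate QUARTIC type is irreducible (`irreducible_of_quartic`: an element `τ` of `Aut(ℂ)` with
`τ² =` conjugation on the embeddings has no rational eigenvalue on a stable line), and the Galois closure of a quartic CM
field carrying a primitive type has degree `4` or `8`, so contains no Galois closure of a sextic field
(`not_normalClosure_le_of_sextic_of_quartic`).  HC_CM is NOT touched.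

## References

* [MoonenZarhin1999LowDim] B. Moonen, Yu. Zarhin, *Hodge classes on abelian varieties of low dimension*, Math. Ann. 315
  (1999), Thm. (0.2), (3.1), (3.9).
* [Gordon1999HodgeAVSurvey] B. B. Gordon, *A survey of the Hodge conjecture for abelian varieties*, §3 Theorem, 7.4–7.7.
* [Shimura1998] G. Shimura, *Abelian Varieties with Complex Multiplication and Modular Functions*, §8.2 Prop. 26, §8.4 (2).
* [Dodson1984] B. Dodson, *The structure of Galois groups of CM-fields*, Trans. AMS 283 (1984), §5.1.2.
-/

noncomputable section

open CategoryTheory CategoryTheory.Limits NumberField Module IntermediateField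

namespace Summit.HodgeConjecture.CorCM

open Literature.NumberTheory.ComplexMultiplication
open Literature.AlgebraicGeometry.Motives (AbelianVariety CMType)
open Literature.AlgebraicGeometry.HodgeTheory
open Literature.AlgebraicGeometry.ComplexMultiplication (IsCMTypeRealisation isSimple_iff_isPrimitive)
open Literature.AlgebraicGeometry.Pohlmann1968

variable {I : Type} {K : I → Type} [∀ i, Field (K i)] [∀ i, NumberField (K i)] [∀ i, IsCMField (K i)]
  {Φ : ∀ i, CMType (K i)}

/-! ## §1 Quartic slots: irreducibility and the degree of the Galois closure -/

section Quartic

/-- **`U(Φ)` of a nondegenerate quartic CM type is irreducible**: `dim U(Φ) = 2`, and some `τ ∈ Aut(ℂ)` satisfies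
`τ ∘ τ ∘ s = s̄` on `Hom(K, ℂ)` (Shimura's `4`-cycle; for a cyclic field a generator); a stable LINE `ℚ f` would give
`f ∘ τ = c f`, `f ∘ τ² = c² f = −f`, `c² = −1` in `ℚ`. [cite: Shimura1998, §8.4 Example (2)] -/
theorem irreducible_of_quartic {i : I} (h4 : finrank ℚ (K i) = 4) (hnd : IsNondegenerate (Φ i)) :
    ∀ W : Submodule ℚ ((K i →+* ℂ) → ℚ), W ≤ antiSpan (ℂ ≃+* ℂ) (Φ i).1 → W ≠ ⊥ →
      (∀ (g : ℂ ≃+* ℂ) (f : (K i →+* ℂ) → ℚ), f ∈ W → (fun y => f (g • y)) ∈ W) → W = antiSpan (ℂ ≃+* ℂ) (Φ i).1 := by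
  classical
  intro W hWU hW0 hWst
  obtain ⟨s₀⟩ : Nonempty (K i →+* ℂ) := inferInstance
  obtain ⟨τ, hτ⟩ := QuarticCM.exists_ringAut_smul_smul_eq_conjugate_of_isPrimitive h4 (hnd.isPrimitive s₀)
  have hdimU : finrank ℚ (antiSpan (ℂ ≃+* ℂ) (Φ i).1) = 2 := by
    rw [(finrank_antiSpan_eq_iff_isNondegenerate i).2 hnd, h4]
  by_contra hne
  -- `W` is a line
  have hlt : finrank ℚ W < 2 := hdimU ▸ Submodule.finrank_lt_finrank_of_lt (lt_of_le_of_ne hWU hne)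
  have hpos : 0 < finrank ℚ W := Nat.pos_of_ne_zero fun h => hW0 (Submodule.finrank_eq_zero.1 h)
  have hW1 : finrank ℚ W = 1 := by omega
  obtain ⟨f, hfW, hf0⟩ := (Submodule.ne_bot_iff W).1 hW0
  -- `f ∘ τ = c • f`
  have hfτ : (fun y => f (τ • y)) ∈ W := hWst τ f hfW
  obtain ⟨c, hc⟩ : ∃ c : ℚ, c • f = fun y => f (τ • y) := by
    have h1 := (finrank_eq_one_iff_of_nonzero' (⟨f, hfW⟩ : W) (by
      intro h; exact hf0 (congrArg Subtype.val h))).1 hW1 ⟨_, hfτ⟩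
    obtain ⟨c, hc⟩ := h1
    exact ⟨c, by have := congrArg Subtype.val hc; simpa using this⟩
  -- `f ∘ τ² = c² f = −f`
  have hρ : ∀ x, f ((starRingAut : ℂ ≃+* ℂ) • x) = -f x :=
    apply_rho_smul_of_mem_antiSpan (isCMTypeWith_conj (Φ i)) (hWU hfW)
  have key : ∀ x, (c * c + 1) * f x = 0 := by
    intro x
    have h1 : f (τ • x) = c * f x := by
      have := congrFun hc x; simp only [Pi.smul_apply, smul_eq_mul] at this; exact this.symm
    have h2 : f (τ • τ • x) = c * f (τ • x) := by
      have := congrFun hc (τ • x); simp only [Pi.smul_apply, smul_eq_mul] at this; exact this.symm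
    have h3 : f (τ • τ • x) = -f x := by rw [hτ x, ← conj_smul_eq_conjugate]; exact hρ x
    have h4 : c * (c * f x) = -f x := by rw [← h1, ← h2, h3]
    linear_combination h4
  apply hf0
  funext x
  have hx := key x
  have hc1 : c * c + 1 ≠ 0 := ne_of_gt (by nlinarith [mul_self_nonneg c])
  exact (mul_eq_zero.1 hx).resolve_left hc1

/-- **The Galois closure of a quartic CM field carrying a nondegenerate (⟺ primitive) type has degree `4` or `8`**
(cyclic Galois, or non-Galois with dihedral closure). [cite: Shimura1998, §8.4 Examples (1), (2)(C)] -/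
theorem finrank_normalClosure_quartic {i : I} (h4 : finrank ℚ (K i) = 4) :
    finrank ℚ ↥(normalClosure ℚ (K i) ℂ) = 4 ∨ finrank ℚ ↥(normalClosure ℚ (K i) ℂ) = 8 := by
  by_cases hG : IsGalois ℚ (K i)
  · left
    rw [finrank_normalClosure_of_normal, h4]
  · right
    haveI : NumberField ↥(normalClosure ℚ (K i) ℂ) := NumberField.mk
    haveI : IsNormalClosure ℚ (K i) ↥(normalClosure ℚ (K i) ℂ) :=
      Algebra.IsAlgebraic.isNormalClosure_normalClosure fun x => IsAlgClosed.splits _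
    exact finrank_normalClosure_eq_eight_of_not_isGalois (L := ↥(normalClosure ℚ (K i) ℂ)) h4 hG

omit [∀ i, IsCMField (K i)] in
/-- `[K_j : ℚ]` divides the degree of the Galois closure of `K_j` in `ℂ` (an embedding lands in it). [folklore] -/
theorem finrank_dvd_finrank_normalClosure (j : I) : finrank ℚ (K j) ∣ finrank ℚ ↥(normalClosure ℚ (K j) ℂ) := by
  obtain ⟨s⟩ : Nonempty (K j →+* ℂ) := inferInstance
  have h1 : finrank ℚ ↥s.toRatAlgHom.fieldRange = finrank ℚ (K j) :=
    ((AlgEquiv.ofInjectiveField s.toRatAlgHom).toLinearEquiv.finrank_eq).symm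
  rw [← h1]
  exact IntermediateField.finrank_dvd_of_le_right s.toRatAlgHom.fieldRange_le_normalClosure

/-- **No Galois closure of a sextic field sits inside the Galois closure of a quartic CM field** (degrees `6 ∤ 4, 8`).
[cite: Shimura1998, §8.4 Examples (1), (2)(C)] -/
theorem not_normalClosure_le_of_sextic_of_quartic {i j : I} (h4 : finrank ℚ (K i) = 4) (h6 : finrank ℚ (K j) = 6) :
    ¬ normalClosure ℚ (K j) ℂ ≤ normalClosure ℚ (K i) ℂ := by
  intro hle
  have h1 := IntermediateField.finrank_dvd_of_le_right hle
  have h2 := finrank_dvd_finrank_normalClosure (K := K) j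
  rw [h6] at h2
  have h3 : 6 ∣ finrank ℚ ↥(normalClosure ℚ (K i) ℂ) := h2.trans h1
  rcases finrank_normalClosure_quartic (K := K) h4 with h | h <;> rw [h] at h3 <;> omega

end Quartic

/-! ## §2 The pair kinds -/

section Pairs

/-- **Two surfaces with different Galois closures**: `U(Φ_i)`, `U(Φ_j)` irreducible and nondegenerate, and one of
`L_i ⊄ L_j`, `L_j ⊄ L_i` holds — criterion (κ). [cite: MoonenZarhin1999LowDim, (3.9)] [cite: Shimura1998, §8.4 (2)] -/
theorem pairwise_quartic_quartic_of_normalClosure_ne {i j : I} (h4i : finrank ℚ (K i) = 4) (h4j : finrank ℚ (K j) = 4)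
    (hndi : IsNondegenerate (Φ i)) (hndj : IsNondegenerate (Φ j))
    (hne : normalClosure ℚ (K i) ℂ ≠ normalClosure ℚ (K j) ℂ) :
    (∀ P : Submodule ℚ ((K i →+* ℂ) → ℚ), P ≤ antiSpan (ℂ ≃+* ℂ) (Φ i).1 →
      (∀ g : ℂ ≃+* ℂ, ∀ f ∈ P, (fun x => f (g • x)) ∈ P) →
      ∀ T : ((K i →+* ℂ) → ℚ) →ₗ[ℚ] ((K j →+* ℂ) → ℚ),
        (∀ g : ℂ ≃+* ℂ, ∀ f ∈ P, T (fun x => f (g • x)) = fun y => T f (g • y)) →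
        (∀ f ∈ P, T f ∈ antiSpan (ℂ ≃+* ℂ) (Φ j).1) → (∀ f ∈ P, T f = 0 → f = 0) → P = ⊥) ∧
    (∀ P : Submodule ℚ ((K j →+* ℂ) → ℚ), P ≤ antiSpan (ℂ ≃+* ℂ) (Φ j).1 →
      (∀ g : ℂ ≃+* ℂ, ∀ f ∈ P, (fun x => f (g • x)) ∈ P) →
      ∀ T : ((K j →+* ℂ) → ℚ) →ₗ[ℚ] ((K i →+* ℂ) → ℚ),
        (∀ g : ℂ ≃+* ℂ, ∀ f ∈ P, T (fun x => f (g • x)) = fun y => T f (g • y)) →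
        (∀ f ∈ P, T f ∈ antiSpan (ℂ ≃+* ℂ) (Φ i).1) → (∀ f ∈ P, T f = 0 → f = 0) → P = ⊥) := by
  by_cases hle : normalClosure ℚ (K i) ℂ ≤ normalClosure ℚ (K j) ℂ
  · have hL : ¬ normalClosure ℚ (K j) ℂ ≤ normalClosure ℚ (K i) ℂ := fun h => hne (le_antisymm hle h)
    have h := pairwise_of_irreducible_of_not_normalClosure_le (Φ := Φ) (irreducible_of_quartic h4j hndj) hndj hL
    exact ⟨h.2, h.1⟩
  · exact pairwise_of_irreducible_of_not_normalClosure_le (Φ := Φ) (irreducible_of_quartic h4i hndi) hndi hle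

/-- **A CM field of degree `≤ 4` against a sextic field with pair flips**: `U(Φ_j)` is irreducible of dimension `3 > 2 ≥
dim U(Φ_i)` — criterion (α). [cite: Gordon1999HodgeAVSurvey, §3 Theorem (proof)] [cite: Dodson1984, §5.1.2 Theorem] -/
theorem pairwise_of_finrank_le_four_pairFlip {i j : I} (h4 : finrank ℚ (K i) ≤ 4) (h6 : finrank ℚ (K j) = 6)
    (hflip : ∀ s : K j →+* ℂ, ∃ σ : ℂ ≃+* ℂ, σ • s = (starRingAut : ℂ ≃+* ℂ) • s ∧
      ∀ t : K j →+* ℂ, t ≠ s → t ≠ (starRingAut : ℂ ≃+* ℂ) • s → σ • t = t) :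
    (∀ P : Submodule ℚ ((K i →+* ℂ) → ℚ), P ≤ antiSpan (ℂ ≃+* ℂ) (Φ i).1 →
      (∀ g : ℂ ≃+* ℂ, ∀ f ∈ P, (fun x => f (g • x)) ∈ P) →
      ∀ T : ((K i →+* ℂ) → ℚ) →ₗ[ℚ] ((K j →+* ℂ) → ℚ),
        (∀ g : ℂ ≃+* ℂ, ∀ f ∈ P, T (fun x => f (g • x)) = fun y => T f (g • y)) →
        (∀ f ∈ P, T f ∈ antiSpan (ℂ ≃+* ℂ) (Φ j).1) → (∀ f ∈ P, T f = 0 → f = 0) → P = ⊥) ∧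
    (∀ P : Submodule ℚ ((K j →+* ℂ) → ℚ), P ≤ antiSpan (ℂ ≃+* ℂ) (Φ j).1 →
      (∀ g : ℂ ≃+* ℂ, ∀ f ∈ P, (fun x => f (g • x)) ∈ P) →
      ∀ T : ((K j →+* ℂ) → ℚ) →ₗ[ℚ] ((K i →+* ℂ) → ℚ),
        (∀ g : ℂ ≃+* ℂ, ∀ f ∈ P, T (fun x => f (g • x)) = fun y => T f (g • y)) →
        (∀ f ∈ P, T f ∈ antiSpan (ℂ ≃+* ℂ) (Φ i).1) → (∀ f ∈ P, T f = 0 → f = 0) → P = ⊥) := by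
  obtain ⟨hirr, hdimj, -⟩ := irreducible_and_finrank_eq_of_pairFlip (Φ := Φ) hflip
  have hle : finrank ℚ (antiSpan (ℂ ≃+* ℂ) (Φ i).1) < finrank ℚ (antiSpan (ℂ ≃+* ℂ) (Φ j).1) := by
    have h1 := finrank_antiSpan_le_finrank_div_two (Φ := Φ) i
    rw [hdimj, h6]; omega
  exact pairwise_of_irreducible_of_finrank_le (G := ℂ ≃+* ℂ) (Φ := fun i => (Φ i).1) hirr hle.le
    (fun h => absurd h hle.ne)

variable {k : Type} [Field k] [NumberField k] [IsTotallyComplex k]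

/-- **A quartic CM field against a sextic field through the imaginary quadratic field `k ↪̸ K_i`**: `L_j ⊄ L_i` by degrees
(`6 ∣ [L_j : ℚ]`, `[L_i : ℚ] ∈ {4, 8}`) — criterion (λ). [cite: MoonenZarhin1999LowDim, Thm. (0.2) (a)] [cite: Shimura1998, §8.4 (2)] -/
theorem pairwise_quartic_quadraticSextic {i j : I} (h4 : finrank ℚ (K i) = 4) (h6 : finrank ℚ (K j) = 6)
    (hk : finrank ℚ k = 2) (e : k →+* K j) (hki : IsEmpty (k →+* K i)) :
    (∀ P : Submodule ℚ ((K i →+* ℂ) → ℚ), P ≤ antiSpan (ℂ ≃+* ℂ) (Φ i).1 →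
      (∀ g : ℂ ≃+* ℂ, ∀ f ∈ P, (fun x => f (g • x)) ∈ P) →
      ∀ T : ((K i →+* ℂ) → ℚ) →ₗ[ℚ] ((K j →+* ℂ) → ℚ),
        (∀ g : ℂ ≃+* ℂ, ∀ f ∈ P, T (fun x => f (g • x)) = fun y => T f (g • y)) →
        (∀ f ∈ P, T f ∈ antiSpan (ℂ ≃+* ℂ) (Φ j).1) → (∀ f ∈ P, T f = 0 → f = 0) → P = ⊥) ∧
    (∀ P : Submodule ℚ ((K j →+* ℂ) → ℚ), P ≤ antiSpan (ℂ ≃+* ℂ) (Φ j).1 →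
      (∀ g : ℂ ≃+* ℂ, ∀ f ∈ P, (fun x => f (g • x)) ∈ P) →
      ∀ T : ((K j →+* ℂ) → ℚ) →ₗ[ℚ] ((K i →+* ℂ) → ℚ),
        (∀ g : ℂ ≃+* ℂ, ∀ f ∈ P, T (fun x => f (g • x)) = fun y => T f (g • y)) →
        (∀ f ∈ P, T f ∈ antiSpan (ℂ ≃+* ℂ) (Φ i).1) → (∀ f ∈ P, T f = 0 → f = 0) → P = ⊥) := by
  have h := pairwise_of_quadratic_sextic_of_not_le (Φ := Φ) hk h6 e (not_normalClosure_le_of_sextic_of_quartic h4 h6) hki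
  exact ⟨h.2, h.1⟩

/-- **Two sextic fields with pair flips and different Galois closures** — criterion (κ) from the side whose closure is not
contained in the other. [cite: Dodson1984, §5.1.2 Theorem] [cite: Gordon1999HodgeAVSurvey, §3 Theorem (proof)] -/
theorem pairwise_pairFlip_pairFlip_of_normalClosure_ne {i j : I}
    (hflipi : ∀ s : K i →+* ℂ, ∃ σ : ℂ ≃+* ℂ, σ • s = (starRingAut : ℂ ≃+* ℂ) • s ∧
      ∀ t : K i →+* ℂ, t ≠ s → t ≠ (starRingAut : ℂ ≃+* ℂ) • s → σ • t = t)
    (hflipj : ∀ s : K j →+* ℂ, ∃ σ : ℂ ≃+* ℂ, σ • s = (starRingAut : ℂ ≃+* ℂ) • s ∧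
      ∀ t : K j →+* ℂ, t ≠ s → t ≠ (starRingAut : ℂ ≃+* ℂ) • s → σ • t = t)
    (hne : normalClosure ℚ (K i) ℂ ≠ normalClosure ℚ (K j) ℂ) :
    (∀ P : Submodule ℚ ((K i →+* ℂ) → ℚ), P ≤ antiSpan (ℂ ≃+* ℂ) (Φ i).1 →
      (∀ g : ℂ ≃+* ℂ, ∀ f ∈ P, (fun x => f (g • x)) ∈ P) →
      ∀ T : ((K i →+* ℂ) → ℚ) →ₗ[ℚ] ((K j →+* ℂ) → ℚ),
        (∀ g : ℂ ≃+* ℂ, ∀ f ∈ P, T (fun x => f (g • x)) = fun y => T f (g • y)) →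
        (∀ f ∈ P, T f ∈ antiSpan (ℂ ≃+* ℂ) (Φ j).1) → (∀ f ∈ P, T f = 0 → f = 0) → P = ⊥) ∧
    (∀ P : Submodule ℚ ((K j →+* ℂ) → ℚ), P ≤ antiSpan (ℂ ≃+* ℂ) (Φ j).1 →
      (∀ g : ℂ ≃+* ℂ, ∀ f ∈ P, (fun x => f (g • x)) ∈ P) →
      ∀ T : ((K j →+* ℂ) → ℚ) →ₗ[ℚ] ((K i →+* ℂ) → ℚ),
        (∀ g : ℂ ≃+* ℂ, ∀ f ∈ P, T (fun x => f (g • x)) = fun y => T f (g • y)) →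
        (∀ f ∈ P, T f ∈ antiSpan (ℂ ≃+* ℂ) (Φ i).1) → (∀ f ∈ P, T f = 0 → f = 0) → P = ⊥) := by
  obtain ⟨hirri, -, hndi⟩ := irreducible_and_finrank_eq_of_pairFlip (Φ := Φ) hflipi
  obtain ⟨hirrj, -, hndj⟩ := irreducible_and_finrank_eq_of_pairFlip (Φ := Φ) hflipj
  by_cases hle : normalClosure ℚ (K i) ℂ ≤ normalClosure ℚ (K j) ℂ
  · have hL : ¬ normalClosure ℚ (K j) ℂ ≤ normalClosure ℚ (K i) ℂ := fun h => hne (le_antisymm hle h)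
    have h := pairwise_of_irreducible_of_not_normalClosure_le (Φ := Φ) hirrj hndj hL
    exact ⟨h.2, h.1⟩
  · exact pairwise_of_irreducible_of_not_normalClosure_le (Φ := Φ) hirri hndi hle

/-- **A sextic field with pair flips against a nondegenerate type of a sextic field through `k`**: criterion (α) — both
modules have dimension `3`, `U(Φ_i)` is irreducible and `U(Φ_j)` has the stable `k`-sign line.
[cite: Dodson1984, §5.1.2 Theorem] [cite: Gordon1999HodgeAVSurvey, §3 Theorem (proof)] -/
theorem pairwise_pairFlip_quadraticSextic {i j : I}
    (hflipi : ∀ s : K i →+* ℂ, ∃ σ : ℂ ≃+* ℂ, σ • s = (starRingAut : ℂ ≃+* ℂ) • s ∧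
      ∀ t : K i →+* ℂ, t ≠ s → t ≠ (starRingAut : ℂ ≃+* ℂ) • s → σ • t = t)
    (h6i : finrank ℚ (K i) = 6) (h6j : finrank ℚ (K j) = 6) (hk : finrank ℚ k = 2) (e : k →+* K j)
    (hndj : IsNondegenerate (Φ j)) :
    (∀ P : Submodule ℚ ((K i →+* ℂ) → ℚ), P ≤ antiSpan (ℂ ≃+* ℂ) (Φ i).1 →
      (∀ g : ℂ ≃+* ℂ, ∀ f ∈ P, (fun x => f (g • x)) ∈ P) →
      ∀ T : ((K i →+* ℂ) → ℚ) →ₗ[ℚ] ((K j →+* ℂ) → ℚ),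
        (∀ g : ℂ ≃+* ℂ, ∀ f ∈ P, T (fun x => f (g • x)) = fun y => T f (g • y)) →
        (∀ f ∈ P, T f ∈ antiSpan (ℂ ≃+* ℂ) (Φ j).1) → (∀ f ∈ P, T f = 0 → f = 0) → P = ⊥) ∧
    (∀ P : Submodule ℚ ((K j →+* ℂ) → ℚ), P ≤ antiSpan (ℂ ≃+* ℂ) (Φ j).1 →
      (∀ g : ℂ ≃+* ℂ, ∀ f ∈ P, (fun x => f (g • x)) ∈ P) →
      ∀ T : ((K j →+* ℂ) → ℚ) →ₗ[ℚ] ((K i →+* ℂ) → ℚ),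
        (∀ g : ℂ ≃+* ℂ, ∀ f ∈ P, T (fun x => f (g • x)) = fun y => T f (g • y)) →
        (∀ f ∈ P, T f ∈ antiSpan (ℂ ≃+* ℂ) (Φ i).1) → (∀ f ∈ P, T f = 0 → f = 0) → P = ⊥) := by
  obtain ⟨hirri, hdimi, -⟩ := irreducible_and_finrank_eq_of_pairFlip (Φ := Φ) hflipi
  have hdimj : finrank ℚ (antiSpan (ℂ ≃+* ℂ) (Φ j).1) = finrank ℚ (K j) / 2 :=
    (finrank_antiSpan_eq_iff_isNondegenerate j).2 hndj
  have h := pairwise_of_irreducible_of_finrank_le (G := ℂ ≃+* ℂ) (Φ := fun i => (Φ i).1) (i := j) (j := i) hirri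
    (by rw [hdimi, hdimj, h6i, h6j]) (fun _ => exists_proper_stable_of_quadratic (Φ := Φ) hk e (by norm_num [h6j]) hdimj)
  exact ⟨h.2, h.1⟩

variable {k' : Type} [Field k'] [NumberField k'] [IsTotallyComplex k']

/-- **Two sextic fields through imaginary quadratic fields `k ↪ K_i`, `k' ↪ K_j` with `k ↪̸ K_j`, `k' ↪̸ K_i` and different
Galois closures** — criterion (λ) from the side whose closure is not contained in the other.
[cite: MoonenZarhin1999LowDim, Thm. (0.2) (a) and (3.9)] -/
theorem pairwise_quadraticSextic_of_normalClosure_ne {i j : I} (h6i : finrank ℚ (K i) = 6) (h6j : finrank ℚ (K j) = 6)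
    (hk : finrank ℚ k = 2) (e : k →+* K i) (hk' : finrank ℚ k' = 2) (e' : k' →+* K j)
    (hkj : IsEmpty (k →+* K j)) (hk'i : IsEmpty (k' →+* K i))
    (hne : normalClosure ℚ (K i) ℂ ≠ normalClosure ℚ (K j) ℂ) :
    (∀ P : Submodule ℚ ((K i →+* ℂ) → ℚ), P ≤ antiSpan (ℂ ≃+* ℂ) (Φ i).1 →
      (∀ g : ℂ ≃+* ℂ, ∀ f ∈ P, (fun x => f (g • x)) ∈ P) →
      ∀ T : ((K i →+* ℂ) → ℚ) →ₗ[ℚ] ((K j →+* ℂ) → ℚ),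
        (∀ g : ℂ ≃+* ℂ, ∀ f ∈ P, T (fun x => f (g • x)) = fun y => T f (g • y)) →
        (∀ f ∈ P, T f ∈ antiSpan (ℂ ≃+* ℂ) (Φ j).1) → (∀ f ∈ P, T f = 0 → f = 0) → P = ⊥) ∧
    (∀ P : Submodule ℚ ((K j →+* ℂ) → ℚ), P ≤ antiSpan (ℂ ≃+* ℂ) (Φ j).1 →
      (∀ g : ℂ ≃+* ℂ, ∀ f ∈ P, (fun x => f (g • x)) ∈ P) →
      ∀ T : ((K j →+* ℂ) → ℚ) →ₗ[ℚ] ((K i →+* ℂ) → ℚ),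
        (∀ g : ℂ ≃+* ℂ, ∀ f ∈ P, T (fun x => f (g • x)) = fun y => T f (g • y)) →
        (∀ f ∈ P, T f ∈ antiSpan (ℂ ≃+* ℂ) (Φ i).1) → (∀ f ∈ P, T f = 0 → f = 0) → P = ⊥) := by
  by_cases hle : normalClosure ℚ (K i) ℂ ≤ normalClosure ℚ (K j) ℂ
  · have hL : ¬ normalClosure ℚ (K j) ℂ ≤ normalClosure ℚ (K i) ℂ := fun h => hne (le_antisymm hle h)
    have h := pairwise_of_quadratic_sextic_of_not_le (Φ := Φ) hk' h6j e' hL hk'i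
    exact ⟨h.2, h.1⟩
  · exact pairwise_of_quadratic_sextic_of_not_le (Φ := Φ) hk h6i e hle hkj

end Pairs

/-! ## §3 Two simple CM abelian varieties of dimension `≤ 3` with different Galois closures -/

section Simple

variable [Fintype I] [DecidableEq I] [Nonempty I]
variable {A : I → AbelianVariety ℂ} {ι : ∀ i, 𝓞 (K i) →+* End (A i)}
  {θ : ∀ i, K i →+* Module.End ℂ (complexBetti (A i).X 1)}

omit [∀ i, IsCMField (K i)] [Fintype I] [DecidableEq I] [Nonempty I] in
/-- The CM field of a realisation of dimension `≤ 3` has degree `2`, `4` or `6`. [cite: Shimura1998, §5.2] -/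
private theorem finrank_eq_or_of_dim_le_three' (hA : ∀ i, IsCMTypeRealisation (Φ i) (A i) (ι i) (θ i)) {i : I}
    (h3 : (A i).dim ≤ 3) : finrank ℚ (K i) = 2 ∨ finrank ℚ (K i) = 4 ∨ finrank ℚ (K i) = 6 := by
  have h := finrank_eq_two_mul_dim_of_isCMTypeRealisation (hA i)
  have hpos : 0 < finrank ℚ (K i) := Module.finrank_pos
  interval_cases hd : (A i).dim <;> omega

omit [Fintype I] [DecidableEq I] [Nonempty I] in
/-- A quadratic CM field mapping to `K_j` is a totally complex quadratic subfield (`⊤`) of itself embedding in `K_j`.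
[cite: Shimura1998, §8.4] -/
private theorem exists_quadratic_subfield_top {i j : I} (h2 : finrank ℚ (K i) = 2) (g : K i →+* K j) :
    ∃ F : IntermediateField ℚ (K i), finrank ℚ F = 2 ∧ IsTotallyComplex F ∧ Nonempty (F →+* K j) := by
  refine ⟨⊤, by rw [IntermediateField.finrank_top', h2], ?_, ⟨g.comp (⊤ : IntermediateField ℚ (K i)).val.toRingHom⟩⟩
  letI : Algebra (K i) ↥(⊤ : IntermediateField ℚ (K i)) :=
    (IntermediateField.topEquiv (F := ℚ) (E := K i)).symm.toRingEquiv.toRingHom.toAlgebra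
  exact isTotallyComplex_of_algebra (K i) _

omit [Fintype I] [DecidableEq I] [Nonempty I] in
/-- A sextic slot: its field has pair flips, or contains a totally complex quadratic field. [cite: Dodson1984, §5.1.2 Theorem] -/
private theorem pairFlip_or_quadratic {j : I} (h6 : finrank ℚ (K j) = 6) :
    (∀ s : K j →+* ℂ, ∃ σ : ℂ ≃+* ℂ, σ • s = (starRingAut : ℂ ≃+* ℂ) • s ∧
        ∀ t : K j →+* ℂ, t ≠ s → t ≠ (starRingAut : ℂ ≃+* ℂ) • s → σ • t = t) ∨
      ∃ F : IntermediateField ℚ (K j), finrank ℚ F = 2 ∧ IsTotallyComplex F :=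
  pairFlip_or_exists_imaginary_quadratic h6

omit [Fintype I] [DecidableEq I] [Nonempty I] in
/-- **THE PAIR KIT.**  Two SIMPLE CM abelian varieties `A_i`, `A_j` of dimension `≤ 3` (realisations of the
types `Φ_i`, `Φ_j` of `K_i`, `K_j`) whose CM fields have DIFFERENT Galois closures in `ℂ` and such that no totally complex
quadratic subfield of one embeds in the other: the `Aut(ℂ)`-modules `U(Φ_i)`, `U(Φ_j)` have no common constituent, in
both orders. [cite: MoonenZarhin1999LowDim, Thm. (0.2), (3.1), (3.9)] [cite: Gordon1999HodgeAVSurvey, §3 Theorem and 7.5] -/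
theorem pairwise_simple_dim_le_three_of_normalClosure_ne (hA : ∀ i, IsCMTypeRealisation (Φ i) (A i) (ι i) (θ i))
    (hS : ∀ i, (A i).IsSimple) (h3 : ∀ i, (A i).dim ≤ 3) {i j : I}
    (hne : normalClosure ℚ (K i) ℂ ≠ normalClosure ℚ (K j) ℂ)
    (hno : ¬ ∃ F : IntermediateField ℚ (K i), finrank ℚ F = 2 ∧ IsTotallyComplex F ∧ Nonempty (F →+* K j))
    (hno' : ¬ ∃ F : IntermediateField ℚ (K j), finrank ℚ F = 2 ∧ IsTotallyComplex F ∧ Nonempty (F →+* K i)) :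
    (∀ P : Submodule ℚ ((K i →+* ℂ) → ℚ), P ≤ antiSpan (ℂ ≃+* ℂ) (Φ i).1 →
      (∀ g : ℂ ≃+* ℂ, ∀ f ∈ P, (fun x => f (g • x)) ∈ P) →
      ∀ T : ((K i →+* ℂ) → ℚ) →ₗ[ℚ] ((K j →+* ℂ) → ℚ),
        (∀ g : ℂ ≃+* ℂ, ∀ f ∈ P, T (fun x => f (g • x)) = fun y => T f (g • y)) →
        (∀ f ∈ P, T f ∈ antiSpan (ℂ ≃+* ℂ) (Φ j).1) → (∀ f ∈ P, T f = 0 → f = 0) → P = ⊥) ∧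
    (∀ P : Submodule ℚ ((K j →+* ℂ) → ℚ), P ≤ antiSpan (ℂ ≃+* ℂ) (Φ j).1 →
      (∀ g : ℂ ≃+* ℂ, ∀ f ∈ P, (fun x => f (g • x)) ∈ P) →
      ∀ T : ((K j →+* ℂ) → ℚ) →ₗ[ℚ] ((K i →+* ℂ) → ℚ),
        (∀ g : ℂ ≃+* ℂ, ∀ f ∈ P, T (fun x => f (g • x)) = fun y => T f (g • y)) →
        (∀ f ∈ P, T f ∈ antiSpan (ℂ ≃+* ℂ) (Φ i).1) → (∀ f ∈ P, T f = 0 → f = 0) → P = ⊥) := by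
  have hndi : IsNondegenerate (Φ i) := isNondegenerate_of_isSimple_of_dim_le_three_slot hA (hS i) (h3 i)
  have hndj : IsNondegenerate (Φ j) := isNondegenerate_of_isSimple_of_dim_le_three_slot hA (hS j) (h3 j)
  -- curves: a quadratic slot is foreign to the other field
  have hcurve_i : finrank ℚ (K i) = 2 → IsEmpty (K i →+* K j) := fun h2 =>
    ⟨fun g => hno (exists_quadratic_subfield_top h2 g)⟩
  have hcurve_j : finrank ℚ (K j) = 2 → IsEmpty (K j →+* K i) := fun h2 =>
    ⟨fun g => hno' (exists_quadratic_subfield_top h2 g)⟩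
  rcases finrank_eq_or_of_dim_le_three' hA (h3 i) with h₀ | h₀ | h₀
  · exact pairwise_of_isEmpty Φ h₀ (hcurve_i h₀)
  · rcases finrank_eq_or_of_dim_le_three' hA (h3 j) with h₁ | h₁ | h₁
    · have h := pairwise_of_isEmpty Φ h₁ (hcurve_j h₁); exact ⟨h.2, h.1⟩
    · exact pairwise_quartic_quartic_of_normalClosure_ne h₀ h₁ hndi hndj hne
    · rcases pairFlip_or_quadratic (K := K) h₁ with hflip | ⟨F, hF2, hFtc⟩
      · exact pairwise_of_finrank_le_four_pairFlip (by omega) h₁ hflip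
      · haveI := hFtc
        exact pairwise_quartic_quadraticSextic (k := ↥F) h₀ h₁ hF2 (algebraMap (↥F) (K j))
          ⟨fun g => hno' ⟨F, hF2, hFtc, ⟨g⟩⟩⟩
  · rcases finrank_eq_or_of_dim_le_three' hA (h3 j) with h₁ | h₁ | h₁
    · have h := pairwise_of_isEmpty Φ h₁ (hcurve_j h₁); exact ⟨h.2, h.1⟩
    · rcases pairFlip_or_quadratic (K := K) h₀ with hflip | ⟨F, hF2, hFtc⟩
      · have h := pairwise_of_finrank_le_four_pairFlip (Φ := Φ) (i := j) (j := i) (by omega) h₀ hflip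
        exact ⟨h.2, h.1⟩
      · haveI := hFtc
        have h := pairwise_quartic_quadraticSextic (Φ := Φ) (k := ↥F) h₁ h₀ hF2 (algebraMap (↥F) (K i))
          ⟨fun g => hno ⟨F, hF2, hFtc, ⟨g⟩⟩⟩
        exact ⟨h.2, h.1⟩
    · rcases pairFlip_or_quadratic (K := K) h₀ with hflipi | ⟨F, hF2, hFtc⟩ <;>
        rcases pairFlip_or_quadratic (K := K) h₁ with hflipj | ⟨F', hF2', hFtc'⟩
      · exact pairwise_pairFlip_pairFlip_of_normalClosure_ne hflipi hflipj hne
      · haveI := hFtc'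
        exact pairwise_pairFlip_quadraticSextic (k := ↥F') hflipi h₀ h₁ hF2' (algebraMap (↥F') (K j)) hndj
      · haveI := hFtc
        have h := pairwise_pairFlip_quadraticSextic (Φ := Φ) (k := ↥F) hflipj h₁ h₀ hF2 (algebraMap (↥F) (K i)) hndi
        exact ⟨h.2, h.1⟩
      · haveI := hFtc
        haveI := hFtc'
        exact pairwise_quadraticSextic_of_normalClosure_ne (k := ↥F) (k' := ↥F') h₀ h₁ hF2 (algebraMap (↥F) (K i)) hF2'
          (algebraMap (↥F') (K j)) ⟨fun g => hno ⟨F, hF2, hFtc, ⟨g⟩⟩⟩ ⟨fun g => hno' ⟨F', hF2', hFtc', ⟨g⟩⟩⟩ hne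

end Simple

end Summit.HodgeConjecture.CorCM

end
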